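import Summits.Ventures.PercRepro.C041BlockMapTriangleHosts

/-!
# ROW C-041 — THE STATUSES OF A FINITE HOST ARE DECIDED: every monochromatic path shortens to fewer steps than
there are vertices (p6, gen 36; the general form of the three-vertex checks of `C041BlockMapTriangleBridge` /
`C041BlockMapCycleDict`)

`Conn R k s v` — `s` reaches `v` in at most `k` steps of `R` — is an explicit predicate (nested `∃` over the
vertices), hence DECIDABLE by `decide` for a concrete host, colouring and colour once `cAdj` and `Joins` are
unfolded.  THEOREM (`reflTransGen_iff_conn`): for a symmetric relation on a finite type with `n` elements,
`ReflTransGen R s v ↔ Conn R (n − 1) s v` — a path of `R` is a walk of the simple graph `fromRel R`, every walk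
shortens to a path (Mathlib's `Walk.toPath`), and a path visits each vertex at most once (`IsPath.length_lt`).
The colour-`c` adjacency of a host is symmetric (`cAdj_symm`), so the merged and reached statuses of any finite
host are `Conn` of the bound `card V − 1` (`Mg_iff_conn`, `Rd_iff_conn`; with an explicit bound
`reflTransGen_iff_conn_of`) — the statuses of the triangle re-derived from the general lemma as the test
(`tri_Mg_01_of_conn`).  With `blockMap_ex2` (two exits) or `blockMap_eq_sum_colTerm` this decides the block map of
every small host colouring by colouring: the tool for the next cores of the row (hosts on four vertices).
-/

namespace PercRepro

namespace ZoneZ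

namespace MultiExit

open ZoneData Pendant Finset TwoExit TreeClosure

/-! ## Paths of bounded length -/

/-- `s` reaches `v` in at most `k` steps of `R`. -/
def Conn {V : Type} (R : V → V → Prop) : ℕ → V → V → Prop
  | 0, s, v => s = v
  | k + 1, s, v => Conn R k s v ∨ ∃ t, R s t ∧ Conn R k t v

section Conn

variable {V : Type} {R : V → V → Prop}

/-- A bound on the number of steps can be raised. -/
theorem Conn.mono {k k' : ℕ} {s v : V} (h : Conn R k s v) (hk : k ≤ k') : Conn R k' s v := by
  induction k' with
  | zero =>
    have : k = 0 := Nat.le_zero.1 hk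
    subst this
    exact h
  | succ k' ih =>
    rcases Nat.eq_or_lt_of_le hk with rfl | hlt
    · exact h
    · exact Or.inl (ih (Nat.le_of_lt_succ hlt))

/-- A path of at most `k` steps is a path. -/
theorem reflTransGen_of_conn {k : ℕ} {s v : V} (h : Conn R k s v) : Relation.ReflTransGen R s v := by
  induction k generalizing s with
  | zero =>
    subst h
    exact Relation.ReflTransGen.refl
  | succ k ih =>
    rcases h with h | ⟨t, hst, htv⟩
    · exact ih h
    · exact Relation.ReflTransGen.head hst (ih htv)

/-- A walk of the simple graph of a symmetric relation is a path of at most its length. -/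
theorem conn_of_walk (hsymm : ∀ x y, R x y → R y x) {s v : V} (p : (SimpleGraph.fromRel R).Walk s v) :
    Conn R p.length s v := by
  induction p with
  | nil => rfl
  | cons h _ ih =>
    refine Or.inr ⟨_, ?_, ih⟩
    rcases h.2 with h' | h'
    · exact h'
    · exact hsymm _ _ h'

/-- A path of a symmetric relation is a walk of its simple graph. -/
theorem reachable_of_reflTransGen {s v : V} (h : Relation.ReflTransGen R s v) :
    (SimpleGraph.fromRel R).Reachable s v := by
  induction h with
  | refl => exact SimpleGraph.Reachable.refl _
  | @tail x y _ hstep ih =>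
    by_cases hxy : x = y
    · rw [← hxy]
      exact ih
    · exact ih.trans (SimpleGraph.Adj.reachable ⟨hxy, Or.inl hstep⟩)

/-- **THE BOUND**: on a finite type with `n` elements, a path of a symmetric relation is a path of at most `n − 1`
steps. -/
theorem conn_of_reflTransGen [Fintype V] [DecidableEq V] (hsymm : ∀ x y, R x y → R y x) {s v : V}
    (h : Relation.ReflTransGen R s v) : Conn R (Fintype.card V - 1) s v := by
  refine (reachable_of_reflTransGen h).elim_path fun p => ?_
  exact (conn_of_walk hsymm p.1).mono (Nat.le_sub_one_of_lt p.isPath.length_lt)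

/-- **Reachability is a path of fewer steps than vertices.** -/
theorem reflTransGen_iff_conn [Fintype V] [DecidableEq V] (hsymm : ∀ x y, R x y → R y x) (s v : V) :
    Relation.ReflTransGen R s v ↔ Conn R (Fintype.card V - 1) s v :=
  ⟨conn_of_reflTransGen hsymm, reflTransGen_of_conn⟩

/-- The same with an explicit bound `k ≥ card V − 1`. -/
theorem reflTransGen_iff_conn_of [Fintype V] [DecidableEq V] (hsymm : ∀ x y, R x y → R y x) {k : ℕ}
    (hk : Fintype.card V ≤ k + 1) (s v : V) : Relation.ReflTransGen R s v ↔ Conn R k s v :=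
  ⟨fun h => (conn_of_reflTransGen hsymm h).mono (Nat.sub_le_of_le_add hk), reflTransGen_of_conn⟩

end Conn

/-! ## The statuses of a finite host -/

variable {V E U₁ U₂ : Type} (Z : ZoneData V E U₁ U₂)

/-- `Joins` is symmetric. -/
theorem joins_symm {e : E} {x y : V} (h : Z.Joins e x y) : Z.Joins e y x := by
  rcases h with ⟨h1, h2⟩ | ⟨h1, h2⟩
  · exact Or.inr ⟨h1, h2⟩
  · exact Or.inl ⟨h1, h2⟩

/-- The adjacency of a colour is symmetric. -/
theorem cAdj_symm (c : Bool) (ω : E → Bool) (x y : V) (h : cAdj Z c ω x y) : cAdj Z c ω y x := by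
  obtain ⟨e, he, hc⟩ := h
  exact ⟨e, joins_symm Z he, hc⟩

variable [Fintype V] [DecidableEq V]

/-- Merged status as a path of fewer steps than vertices. -/
theorem Mg_iff_conn {k : ℕ} (hk : Fintype.card V ≤ k + 1) (s v : V) (ω : E → Bool) :
    Z.Mg s v ω ↔ Conn (cAdj Z false ω) k s v := by
  rw [Mg_iff_reflTransGen]
  exact reflTransGen_iff_conn_of (cAdj_symm Z false ω) hk s v

/-- Reached status as a path of fewer steps than vertices. -/
theorem Rd_iff_conn {k : ℕ} (hk : Fintype.card V ≤ k + 1) (s v : V) (ω : E → Bool) :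
    Z.Rd s v ω ↔ Conn (cAdj Z true ω) k s v := by
  rw [Rd_iff_reflTransGen]
  exact reflTransGen_iff_conn_of (cAdj_symm Z true ω) hk s v

/-! ## The test: the triangle's status from the general lemma -/

/-- The exit `1` of the triangle is merged iff the edge `0 → 1` is blue or the two other edges are — decided
through the general bound (two steps on three vertices). -/
theorem tri_Mg_01_of_conn (b₀ b₁ b₂ : Bool) :
    tri.Mg 0 1 ![b₀, b₁, b₂] ↔ (b₀ = false ∨ (b₁ = false ∧ b₂ = false)) := by
  rw [Mg_iff_conn tri (k := 2) (by simp)]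
  revert b₀ b₁ b₂
  simp only [Conn]
  unfold cAdj ZoneData.Joins
  decide

end MultiExit

end ZoneZ

end PercRepro
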